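import Summits.Ventures.CertifiedArithmetic.Expansions.Orient2dStageBBounds
import Mathlib.Tactic.Linarith
import Mathlib.Tactic.Positivity
import Mathlib.Tactic.Ring
import Mathlib.Tactic.NormNum

/-!
# Stage C of ORIENT2D, part 1: the error analysis behind `ccwerrboundC = (9 + 64ε)ε²` and
`resulterrbound = (3 + 8ε)ε`

NEW WORK in the sense of this development: the algorithm and the two constants are Shewchuk's
(`predicates.c`, `orient2dadapt`; Table 1, line C), the error analysis is ours — the paper derives only
line A in print (§4.3 p. 348).

After stage B falls through, `orient2dadapt` computes the tails `τ₁ = acxtail, τ₂ = bcytail,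
τ₃ = acytail, τ₄ = bcxtail` of the four coordinate differences (TWO-DIFF-TAIL, exact), returns the
stage-B `det` if all four vanish (that exit is the subject of `Orient2dEstimate.lean` /
`Orient2dEstimateZero.lean`), and otherwise sets
`errbound = (ccwerrboundC ⊗ detsum) ⊕ (resulterrbound ⊗ |det|)`,
`det += ((acx ⊗ τ₂) ⊕ (bcy ⊗ τ₁)) ⊖ ((acy ⊗ τ₄) ⊕ (bcx ⊗ τ₃))` and returns `det` if `|det| ≥ errbound`.

* `stageC_sign_of_bounds` — the error analysis as an inequality between rationals (`0 < ε ≤ 1/16`),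
  with every floating-point fact entering as a hypothesis on named quantities: `s = |x₅| + |x₆|`
  (exact), `S` = `detsum` (`S = s ± εs`), `Σ = x₁x₂ − x₃x₄` (the exact sum of block `B`), `d_B` = the
  stage-B estimate with `|d_B − Σ| ≤ (ε + 4ε²)|d_B| + (ε² + 3ε³)s` (this covers both shapes of `B`
  analysed in `Orient2dStageBBounds`: `B₂ = 0` gives `ε|d_B| + (ε² + 2ε³ + ε⁴ + ε⁵)s`, `B₂ ≠ 0` gives
  `ε|d_B| + 3ε²|B₃|` with `|B₃| ≤ |d_B| / ((1 − 2ε)(1 − ε)) ≤ (4/3)|d_B|`), the linear correction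
  `L = x₁τ₂ + x₂τ₁ − x₃τ₄ − x₄τ₃` and its computed value `c` (`|c − L| ≤ ε|c| + 2ε²(1 + ε)(2 + ε)s`,
  `|c| ≤ 2ε(1 + ε)⁴ s`: each `|τᵢ| ≤ ε|xᵢ|`, `|x₁x₂| ≤ (1 + ε)|x₅|`), the quadratic remainder
  `τ = τ₁τ₂ − τ₃τ₄` (`|τ| ≤ ε²(1 + ε)s`), the returned value `d_C = d_B ⊕ c`
  (`|d_C − (d_B + c)| ≤ ε|d_C|`), the two ROUNDED constants `K_C ≥ (1 − ε)(9 + 64ε)ε²`,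
  `K_R ≥ (1 − ε)(3 + 8ε)ε` and the computed bound `E ≥ (1 − ε)((1 − ε)K_C S + (1 − ε)K_R|d_B|)`.
  Conclusion: if the test `E ≤ |d_C|` passes then `d_C` has the sign of the true determinant
  `T = Σ + L + τ`.  The proof shows `|d_C − T| + (ε|d_B| + ε²s)/16 ≤ |d_C|`; the two margins are
  `ε·(31/16 − 8ε − 14ε² + 36ε³ − 29ε⁴ + 8ε⁵)` on the `|d_B|` terms and
  `ε²·(15/16 + ε − 244ε² + 542ε³ − 597ε⁴ + 311ε⁵ − 64ε⁶)` on the `s` terms, nonnegative for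
  `ε ≤ 1/16` (`p ≥ 4`; the second is negative at `p = 3`).
* `ccwerrboundC`, `resulterrbound` (with their grids) and `orient2dStageC` (the stage-C test as an
  `Option`).

Part 2 — discharging the hypotheses from the floating-point model, as `Orient2dStageB.lean` does for
stage B — is not in this file.  Evidence gathered before typing (exact rational model, round-half-even,
random nearly-collinear triples with inexact coordinate differences; `p = 4, 5, 6, 8`, 60 000 / 20 000 /
60 000 / 60 000 trials, 2 089 / 1 716 / 7 016 / 8 535 stage-C returns): no wrong sign, and each of
the component inequalities above held in every trial.
References: J. R. Shewchuk, Discrete Comput. Geom. 18 (1997) 305–363, §4.3 (Fig. 21, Table 1) and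
`predicates.c` (`orient2dadapt`) [Shewchuk1997].
-/

namespace Summit.Ventures.CertifiedArithmetic.Expansions

open Literature.ComputerArithmetic.JeannerodRump2018
open Literature.ComputerArithmetic.Shewchuk1997

variable {p : ℕ} {emin : ℤ} {fl : ℚ → ℚ}

/-! ## The inequality -/

/-- **Stage C of `orient2dadapt` is sound, as an inequality** (`0 < ε ≤ 1/16`).  See the module
docstring for the meaning of the quantities; every hypothesis is a floating-point fact to be supplied
by part 2.  If the stage-C test `E ≤ |d_C|` passes, `d_C` is nonzero exactly with the sign of the
true determinant `T = Σ + L + τ` (`Σ` is the binder `A`). -/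
theorem stageC_sign_of_bounds {u s S A dB dC c L τ T KC KR E : ℚ} (hu0 : 0 < u) (hu : u ≤ 1 / 16)
    (hs : 0 ≤ s) (hS : |s - S| ≤ u * s) (hT : T = A + L + τ)
    (hdB : |dB - A| ≤ (u + 4 * u ^ 2) * |dB| + (u ^ 2 + 3 * u ^ 3) * s)
    (hcL : |c - L| ≤ u * |c| + 2 * u ^ 2 * (1 + u) * (2 + u) * s)
    (hcc : |c| ≤ 2 * u * (1 + u) ^ 4 * s) (hτ : |τ| ≤ u ^ 2 * (1 + u) * s)
    (hdC : |dC - (dB + c)| ≤ u * |dC|)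
    (hKC : (1 - u) * ((9 + 64 * u) * u ^ 2) ≤ KC) (hKR : (1 - u) * ((3 + 8 * u) * u) ≤ KR)
    (hE : (1 - u) * ((1 - u) * (KC * S) + (1 - u) * (KR * |dB|)) ≤ E) (htest : E ≤ |dC|) :
    (0 < dC → 0 < T) ∧ (dC < 0 → T < 0) := by
  set K9 := (9 + 64 * u) * u ^ 2 with hK9
  set K3 := (3 + 8 * u) * u with hK3
  have h1u : 0 ≤ 1 - u := by linarith
  -- the computed bound from below: `(1 − ε)⁵ K9 s + (1 − ε)⁴ K3 |d_B| ≤ (1 − ε)|d_C|`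
  have hS1 : (1 - u) * s ≤ S := by
    have := (abs_sub_le_iff.mp hS).1
    linarith
  have hS0 : 0 ≤ S := le_trans (mul_nonneg h1u hs) hS1
  have hK9nn : 0 ≤ (1 - u) * K9 := by positivity
  have hKCS : (1 - u) * K9 * ((1 - u) * s) ≤ KC * S :=
    (mul_le_mul_of_nonneg_left hS1 hK9nn).trans (mul_le_mul_of_nonneg_right hKC hS0)
  have hKRd : (1 - u) * K3 * |dB| ≤ KR * |dB| := mul_le_mul_of_nonneg_right hKR (abs_nonneg _)
  have hX : (1 - u) ^ 5 * K9 * s + (1 - u) ^ 4 * K3 * |dB| ≤ (1 - u) * |dC| := by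
    have h3 : (1 - u) * ((1 - u) * K9 * ((1 - u) * s)) + (1 - u) * ((1 - u) * K3 * |dB|) ≤
        (1 - u) * (KC * S) + (1 - u) * (KR * |dB|) :=
      add_le_add (mul_le_mul_of_nonneg_left hKCS h1u) (mul_le_mul_of_nonneg_left hKRd h1u)
    have h4 := mul_le_mul_of_nonneg_left
      ((mul_le_mul_of_nonneg_left h3 h1u).trans (hE.trans htest)) h1u
    have hid : (1 - u) * ((1 - u) * ((1 - u) * ((1 - u) * K9 * ((1 - u) * s)) +
        (1 - u) * ((1 - u) * K3 * |dB|))) = (1 - u) ^ 5 * K9 * s + (1 - u) ^ 4 * K3 * |dB| := by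
      ring
    linarith
  -- the error from above: `|d_C − T| ≤ ε|d_C| + (ε + 4ε²)|d_B| + (…)s`
  have hdec : dC - T = (dC - (dB + c)) + (dB - A) + (c - L) - τ := by rw [hT]; ring
  have hup : |dC - T| ≤ u * |dC| + (u + 4 * u ^ 2) * |dB| + (u ^ 2 + 3 * u ^ 3) * s +
      (u * |c| + 2 * u ^ 2 * (1 + u) * (2 + u) * s) + u ^ 2 * (1 + u) * s := by
    rw [hdec]
    have a1 := abs_sub ((dC - (dB + c)) + (dB - A) + (c - L)) τ
    have a2 := abs_add_le ((dC - (dB + c)) + (dB - A)) (c - L)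
    have a3 := abs_add_le (dC - (dB + c)) (dB - A)
    linarith
  have huc : u * |c| ≤ u * (2 * u * (1 + u) ^ 4 * s) := mul_le_mul_of_nonneg_left hcc hu0.le
  -- the two margins
  have hu2 : u ^ 2 ≤ u / 16 := by
    rw [pow_two]
    have := mul_le_mul_of_nonneg_left hu hu0.le
    linarith
  have hF1 : 0 ≤ 31 / 16 - 8 * u - 14 * u ^ 2 + 36 * u ^ 3 - 29 * u ^ 4 + 8 * u ^ 5 := by
    have h3 : 0 ≤ u ^ 3 * (36 - 29 * u) := mul_nonneg (pow_nonneg hu0.le 3) (by linarith)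
    have h5 := pow_nonneg hu0.le 5
    linarith
  have hF2 : 0 ≤ 15 / 16 + u - 244 * u ^ 2 + 542 * u ^ 3 - 597 * u ^ 4 + 311 * u ^ 5
      - 64 * u ^ 6 := by
    have h3 : 0 ≤ u ^ 3 * (542 - 597 * u) := mul_nonneg (pow_nonneg hu0.le 3) (by linarith)
    have h5 : 0 ≤ u ^ 5 * (311 - 64 * u) := mul_nonneg (pow_nonneg hu0.le 5) (by linarith)
    linarith
  have g1 : (u + 4 * u ^ 2 + u / 16) * |dB| ≤ (1 - u) ^ 4 * K3 * |dB| := by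
    have hid : (1 - u) ^ 4 * K3 - (u + 4 * u ^ 2 + u / 16) =
        u * (31 / 16 - 8 * u - 14 * u ^ 2 + 36 * u ^ 3 - 29 * u ^ 4 + 8 * u ^ 5) := by
      rw [hK3]; ring
    have hnn := mul_nonneg (mul_nonneg hu0.le hF1) (abs_nonneg dB)
    rw [← hid] at hnn
    linarith
  have g2 : ((u ^ 2 + 3 * u ^ 3) + u * (2 * u * (1 + u) ^ 4) + 2 * u ^ 2 * (1 + u) * (2 + u) +
      u ^ 2 * (1 + u) + u ^ 2 / 16) * s ≤ (1 - u) ^ 5 * K9 * s := by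
    have hid : (1 - u) ^ 5 * K9 - ((u ^ 2 + 3 * u ^ 3) + u * (2 * u * (1 + u) ^ 4) +
        2 * u ^ 2 * (1 + u) * (2 + u) + u ^ 2 * (1 + u) + u ^ 2 / 16) =
        u ^ 2 * (15 / 16 + u - 244 * u ^ 2 + 542 * u ^ 3 - 597 * u ^ 4 + 311 * u ^ 5
          - 64 * u ^ 6) := by
      rw [hK9]; ring
    have hnn := mul_nonneg (mul_nonneg (pow_nonneg hu0.le 2) hF2) hs
    rw [← hid] at hnn
    linarith
  have key : |dC - T| + (u * |dB| + u ^ 2 * s) / 16 ≤ |dC| := by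
    linarith [hup, huc, g1, g2, hX]
  -- the degenerate case: the slack vanishes only if `d_B = 0` and `s = 0`, and then `d_C = 0`
  have hslack : dC ≠ 0 → 0 < u * |dB| + u ^ 2 * s := by
    intro hne
    by_contra hle
    have hle' := not_lt.mp hle
    have hn1 : 0 ≤ u * |dB| := mul_nonneg hu0.le (abs_nonneg _)
    have hn2 : 0 ≤ u ^ 2 * s := mul_nonneg (pow_nonneg hu0.le 2) hs
    have e1 : u * |dB| = 0 := le_antisymm (by linarith) hn1
    have e2 : u ^ 2 * s = 0 := le_antisymm (by linarith) hn2
    have hdB0 : dB = 0 := by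
      rcases mul_eq_zero.mp e1 with h | h
      · exact absurd h hu0.ne'
      · exact abs_eq_zero.mp h
    have hs0 : s = 0 := by
      rcases mul_eq_zero.mp e2 with h | h
      · exact absurd h (pow_ne_zero 2 hu0.ne')
      · exact h
    have hc0 : c = 0 := by
      have : |c| ≤ 0 := by simpa [hs0] using hcc
      exact abs_eq_zero.mp (le_antisymm this (abs_nonneg c))
    have h1 : |dC| ≤ u * |dC| := by simpa [hdB0, hc0] using hdC
    have h2 := mul_le_mul_of_nonneg_right hu (abs_nonneg dC)
    have h3 : |dC| ≤ 0 := by linarith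
    exact hne (abs_eq_zero.mp (le_antisymm h3 (abs_nonneg dC)))
  constructor
  · intro hpos
    by_contra hT0
    have hT0' := not_lt.mp hT0
    have hsl := hslack hpos.ne'
    rw [abs_of_pos hpos, abs_of_nonneg (by linarith : (0 : ℚ) ≤ dC - T)] at key
    linarith
  · intro hneg
    by_contra hT0
    have hT0' := not_lt.mp hT0
    have hsl := hslack hneg.ne
    rw [abs_of_neg hneg, abs_of_nonpos (by linarith : dC - T ≤ 0)] at key
    linarith

/-! ## Stage C of `orient2dadapt` -/

/-- The coefficient `ccwerrboundC = (9 + 64ε)ε²` of Table 1, line C (`ε = 2^−p`; `predicates.c`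
`exactinit`: `ccwerrboundC = (9.0 + 64.0 * epsilon) * epsilon * epsilon`). -/
def ccwerrboundC (p : ℕ) : ℚ := (9 + 64 * unitRoundoff p) * unitRoundoff p * unitRoundoff p

/-- The coefficient `resulterrbound = (3 + 8ε)ε` (`predicates.c` `exactinit`:
`resulterrbound = (3.0 + 8.0 * epsilon) * epsilon`), multiplying `|det|` in the stage-C bound. -/
def resulterrbound (p : ℕ) : ℚ := (3 + 8 * unitRoundoff p) * unitRoundoff p

/-- `resulterrbound = (3·2^p + 8)·2^(−2p)` lies on the grid `2^(−2p) ℤ`. -/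
theorem onGrid_resulterrbound (p : ℕ) : OnGrid (-(2 * (p : ℤ))) (resulterrbound p) := by
  refine ⟨3 * 2 ^ p + 8, ?_⟩
  unfold resulterrbound unitRoundoff
  have h2 : (2 : ℚ) ^ p ≠ 0 := pow_ne_zero _ (by norm_num)
  rw [show (-(2 * (p : ℤ))) = -((p : ℤ) + (p : ℤ)) by ring, zpow_neg, zpow_add₀ (by norm_num),
    zpow_natCast]
  push_cast
  field_simp

/-- `ccwerrboundC = (9·2^p + 64)·2^(−3p)` lies on the grid `2^(−3p) ℤ`. -/
theorem onGrid_ccwerrboundC (p : ℕ) : OnGrid (-(3 * (p : ℤ))) (ccwerrboundC p) := by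
  refine ⟨9 * 2 ^ p + 64, ?_⟩
  unfold ccwerrboundC unitRoundoff
  have h2 : (2 : ℚ) ^ p ≠ 0 := pow_ne_zero _ (by norm_num)
  rw [show (-(3 * (p : ℤ))) = -((p : ℤ) + (p : ℤ) + (p : ℤ)) by ring, zpow_neg,
    zpow_add₀ (by norm_num), zpow_add₀ (by norm_num), zpow_natCast]
  push_cast
  field_simp

/-- `predicates.c`, `orient2dadapt`, stage C (reached when stage B falls through and not all four
tails vanish): with `acx = fl (a₁ − c₁)`, … and the exact tails `acxtail = (a₁ − c₁) − acx`, …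
(what TWO-DIFF-TAIL returns, `twoDiff_exact`), `det` the stage-B estimate (`orient2dDetB`),
`errbound = (K_C ⊗ detsum) ⊕ (K_R ⊗ |det|)`,
`det' = det ⊕ (((acx ⊗ bcytail) ⊕ (bcy ⊗ acxtail)) ⊖ ((acy ⊗ bcxtail) ⊕ (bcx ⊗ acytail)))`, and
`if ((det' >= errbound) || (-det' >= errbound)) return det';`.  `some det'` = stage C answers,
`none` = fall through to stage D.  `K_C`, `K_R` are the coefficients, `detsum` the stage-A value. -/
def orient2dStageC (tp : ℚ → ℚ → ℚ × ℚ) (fl : ℚ → ℚ) (KC KR detsum a₁ a₂ b₁ b₂ c₁ c₂ : ℚ) :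
    Option ℚ :=
  let acx := fl (a₁ - c₁)
  let bcy := fl (b₂ - c₂)
  let acy := fl (a₂ - c₂)
  let bcx := fl (b₁ - c₁)
  let acxtail := (a₁ - c₁) - acx
  let bcytail := (b₂ - c₂) - bcy
  let acytail := (a₂ - c₂) - acy
  let bcxtail := (b₁ - c₁) - bcx
  let det := orient2dDetB tp fl a₁ a₂ b₁ b₂ c₁ c₂
  let errbound := fl (fl (KC * detsum) + fl (KR * |det|))
  let det' := fl (det + fl (fl (fl (acx * bcytail) + fl (bcy * acxtail)) -
    fl (fl (acy * bcxtail) + fl (bcx * acytail))))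
  if errbound ≤ det' ∨ errbound ≤ -det' then some det' else none

end Summit.Ventures.CertifiedArithmetic.Expansions
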